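import Summits.ResolutionOfSingularities.ResolutionOfSingularities.Theorems.EquisingularLiftEquisingularLiftNatOccursAsSingularLocus
import Mathlib.RingTheory.Nakayama
import HarnessLib

/-!
# [OURS · L1 W4.5(b)] Helper H-L0b, part 2: the generic member of the `𝔭²`-system has ORDER EXACTLY 2
# along `V(𝔭)` — crux `EquisingularLiftNat` (EL♮, stmt-ResolutionOfSingularities-20038), line `sections`

NOT a statement of any manuscript. Add-on to
`Theorems/EquisingularLiftEquisingularLiftNatOccursAsSingularLocus.lean` (p500339: the closed singular
points of the generic member `H = V(s_t)` of the affine `𝔭²`-system are exactly those of `V(𝔭)`).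
CRUX-PLAN v3.0.1 §1.3 (b) wants `Sing H = Σ` with `H` of multiplicity `2` along `Σ` («transversal
type `A₁` off finitely many points»); this file proves the first-order half of that clause at the
generic point `η = 𝔭` of `Σ`:

* `isGeneric_apply_linComb_ne_zero` — generic non-vanishing of `F(s_t)` for any `k`-linear map `F`
  with some `F(uⱼ) ≠ 0` (the tree's `BertiniAffine.isGeneric_ne_zero_of_linearMap` tested against
  a linear functional through `F`).
* `exists_mem_notMem_maximalIdeal_pow_three` — for a non-zero prime `𝔭` of a Noetherian domain `A`
  and generators `T` of `𝔭²`, some `g ∈ T` has `g ∉ 𝔪³` in `A_𝔭` (else `𝔪² = 𝔪³` in `A_𝔭`,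
  Nakayama gives `𝔪² = 0`, hence `𝔪 = 0` in the domain `A_𝔭`, i.e. `𝔭 = 0`).
* `isGeneric_linComb_notMem_maximalIdeal_pow` — hence for generic `t`, `s_t ∉ 𝔪³_{A_𝔭}`.
* `occurs_as_singular_locus_ord_two` — **H-L0b with order**: for a non-zero PRIME `𝔭` of a regular
  domain `A` of finite type over `k = k̄` there are finitely many `uⱼ ∈ 𝔭²` such that for generic
  `t`: `s_t ≠ 0`, `s_t ∈ 𝔭²` and `s_t ∉ 𝔭³A_𝔭 = 𝔪³_{A_𝔭}` (ORDER EXACTLY 2 at the generic point of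
  `V(𝔭)`: the hypersurface `V(s_t)` has multiplicity `2`, not more, along `Σ`), and the closed
  singular points of `V(s_t)` are exactly the closed points of `V(𝔭)`.

Still NOT covered (module docstring of part 1): integrality for `d ≫ 0`, transversal type `A₁` off
finitely many closed points (the second-order / Hessian condition), projective gluing.
References: Matsumura, *Commutative Ring Theory* Thm. 2.2 (Nakayama), Thm. 14.2 [Matsumura1987];
Hartshorne II Thm. 8.18 [Hartshorne1977].
-/

set_option linter.dupNamespace false -- mandated namespace `Summit.<Summit>.<Problem>` of this single-conjunct summit

noncomputable section

open IsLocalRing MvPolynomial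

universe u v w

namespace Summit.ResolutionOfSingularities.ResolutionOfSingularities.Cruxes.EquisingularLiftNat.Sections

open Literature.AlgebraicGeometry.Resolution Literature.AlgebraicGeometry.Resolution.BertiniAffine

variable {k : Type u} [Field k] {A : Type u} [CommRing A] [Algebra k A]
variable {ι : Type v} [Fintype ι]

/-- **Generic non-vanishing through a linear map**: for a `k`-linear `F : A → V` and functions `uⱼ`
with some `F(uⱼ) ≠ 0`, `F(s_t) ≠ 0` for generic `t` (test against a linear functional `φ` on `V`
with `φ(F uⱼ) ≠ 0`; `V` is a vector space, so such `φ` exists). [folklore]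
[OURS · L1 W4.5b] helper for H-L0b. -/
theorem isGeneric_apply_linComb_ne_zero {V : Type w} [AddCommGroup V] [Module k V]
    (F : A →ₗ[k] V) (u : ι → A) (h : ∃ j, F (u j) ≠ 0) :
    IsGeneric fun t : ι → k => F (linComb u t) ≠ 0 := by
  classical
  obtain ⟨j, hj⟩ := h
  obtain ⟨φ, hφ⟩ := Module.Projective.exists_dual_ne_zero k hj
  let L : (ι → k) →ₗ[k] V := F ∘ₗ Fintype.linearCombination k u
  have hL : ∀ t, L t = F (linComb u t) := fun t => by
    simp only [L, LinearMap.comp_apply, Fintype.linearCombination_apply, linComb]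
  let ψ : (ι → k) →ₗ[k] k := φ ∘ₗ L
  have hψ : ψ ≠ 0 := by
    intro h0
    apply hφ
    have h1 : ψ (Pi.single j 1) = 0 := by rw [h0, LinearMap.zero_apply]
    have h2 : L (Pi.single j 1) = F (u j) := by
      rw [hL]
      congr 1
      simp [linComb, Pi.single_apply, Finset.sum_ite_eq', Finset.mem_univ]
    simpa [ψ, h2] using h1
  refine (isGeneric_ne_zero_of_linearMap ψ hψ).mono fun t ht h0 => ht ?_
  change φ (L t) = 0
  rw [hL, h0, map_zero]

omit [Algebra k A] in
/-- **Some generator of `𝔭²` has order exactly `2` at `𝔭`**: for a non-zero prime `𝔭` of a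
Noetherian domain `A` and a finite set `T` generating `𝔭²`, some `g ∈ T` satisfies `g ∉ 𝔪³` in
the local ring `A_𝔭` (`𝔪 = 𝔭A_𝔭`). Otherwise `𝔪² = 𝔭²A_𝔭 ⊆ 𝔪³ = 𝔪·𝔪²`, so `𝔪² = 0` by Nakayama,
hence `𝔪 = 0` in the domain `A_𝔭` and `𝔭 = 0`. [cite: Matsumura1987, Thm. 2.2]
[OURS · L1 W4.5b] helper for H-L0b. -/
theorem exists_mem_notMem_maximalIdeal_pow_three [IsDomain A] [IsNoetherianRing A]
    (𝔭 : Ideal A) [𝔭.IsPrime] (h𝔭 : 𝔭 ≠ ⊥) {T : Finset A}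
    (hT : Ideal.span (T : Set A) = 𝔭 ^ 2) :
    ∃ g ∈ (T : Set A), algebraMap A (Localization.AtPrime 𝔭) g ∉
      maximalIdeal (Localization.AtPrime 𝔭) ^ 3 := by
  set S := Localization.AtPrime 𝔭
  haveI : IsNoetherianRing S := IsLocalization.isNoetherianRing 𝔭.primeCompl S inferInstance
  by_contra hcon
  push Not at hcon
  -- then `𝔪² ≤ 𝔪³` in `S = A_𝔭`
  have hmap : (𝔭 ^ 2).map (algebraMap A S) = maximalIdeal S ^ 2 := by
    rw [Ideal.map_pow, Localization.AtPrime.map_eq_maximalIdeal]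
  have hle : maximalIdeal S ^ 2 ≤ maximalIdeal S ^ 3 := by
    rw [← hmap, ← hT, Ideal.map_span]
    refine Ideal.span_le.2 ?_
    rintro _ ⟨g, hg, rfl⟩
    exact hcon g hg
  -- Nakayama: `𝔪² = 𝔪 • 𝔪²` forces `𝔪² = 0`
  have hfg : (maximalIdeal S ^ 2).FG := (isNoetherian_def.mp inferInstance) _
  have hbot : maximalIdeal S ^ 2 = ⊥ := by
    refine Submodule.eq_bot_of_le_smul_of_le_jacobson_bot (maximalIdeal S) (maximalIdeal S ^ 2)
      hfg ?_ (IsLocalRing.maximalIdeal_le_jacobson _)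
    rw [Ideal.smul_eq_mul, ← pow_succ']
    exact hle
  -- `S` is a domain containing `A`, so `𝔭 = 0`
  have hinj : Function.Injective (algebraMap A S) :=
    IsLocalization.injective S (Ideal.primeCompl_le_nonZeroDivisors 𝔭)
  haveI : IsDomain S := IsLocalization.isDomain_of_le_nonZeroDivisors (M := 𝔭.primeCompl) (S := S)
    (Ideal.primeCompl_le_nonZeroDivisors 𝔭)
  apply h𝔭
  refine (Submodule.eq_bot_iff _).2 fun p hp => ?_
  have hpm : algebraMap A S p ∈ maximalIdeal S := by
    rw [← Localization.AtPrime.map_eq_maximalIdeal]; exact Ideal.mem_map_of_mem _ hp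
  have hp2 : algebraMap A S p * algebraMap A S p ∈ maximalIdeal S ^ 2 := by
    rw [pow_two]; exact Ideal.mul_mem_mul hpm hpm
  rw [hbot, Ideal.mem_bot, mul_self_eq_zero] at hp2
  exact hinj (by rw [hp2, map_zero])

/-- **Generic order**: if some `uⱼ ∉ 𝔪ⁿ` in `A_𝔭`, then `s_t ∉ 𝔪ⁿ_{A_𝔭}` for generic `t`
(`isGeneric_apply_linComb_ne_zero` for the `k`-linear map `A → A_𝔭 ⧸ 𝔪ⁿ`). [folklore]
[OURS · L1 W4.5b] helper for H-L0b. -/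
theorem isGeneric_linComb_notMem_maximalIdeal_pow (𝔭 : Ideal A) [𝔭.IsPrime] (n : ℕ)
    (u : ι → A) (h : ∃ j, algebraMap A (Localization.AtPrime 𝔭) (u j) ∉
      maximalIdeal (Localization.AtPrime 𝔭) ^ n) :
    IsGeneric fun t : ι → k => algebraMap A (Localization.AtPrime 𝔭) (linComb u t) ∉
      maximalIdeal (Localization.AtPrime 𝔭) ^ n := by
  set S := Localization.AtPrime 𝔭
  let F : A →ₗ[k] S ⧸ maximalIdeal S ^ n :=
    ((Ideal.Quotient.mkₐ k (maximalIdeal S ^ n)).comp (IsScalarTower.toAlgHom k A S)).toLinearMap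
  have hF : ∀ a, F a = Ideal.Quotient.mk (maximalIdeal S ^ n) (algebraMap A S a) := fun _ => rfl
  have h' : ∃ j, F (u j) ≠ 0 := by
    obtain ⟨j, hj⟩ := h
    exact ⟨j, by rwa [hF, Ne, Ideal.Quotient.eq_zero_iff_mem]⟩
  refine (isGeneric_apply_linComb_ne_zero F u h').mono fun t ht hmem => ht ?_
  rw [hF, Ideal.Quotient.eq_zero_iff_mem]
  exact hmem

/-- **H-L0b with order (`occurs_as_singular_locus_ord_two`)**: let `A` be a regular domain of
finite type over an algebraically closed field `k` and `𝔭` a non-zero PRIME ideal (the chart of an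
irreducible `Σ`). Then there are finitely many `uⱼ ∈ 𝔭²` (the affine `𝔭²`-system `{g · 1, g · xᵢ}`
of part 1) such that for GENERIC `t`: `s_t = Σ tⱼ uⱼ ≠ 0`, `s_t ∈ 𝔭²`, **`s_t ∉ 𝔪³` in `A_𝔭`**
(order exactly `2` at the generic point of `V(𝔭)` — the hypersurface `V(s_t)` has multiplicity `2`,
not more, along `Σ`), and for every closed point `𝔪 ∋ s_t`: `A_𝔪 ⧸ (s_t)` is regular iff `𝔪 ⊉ 𝔭`
(closed singular locus `= V(𝔭)` on closed points). Proof: part 1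
(`isGeneric_isRegularLocalRing_quotient_linComb_off`, `not_isRegularLocalRing_quotient_of_mem_sq`,
`surjective_linCombQuotSq_sqSystem`, `isGeneric_linComb_ne_zero`) plus
`exists_mem_notMem_maximalIdeal_pow_three` / `isGeneric_linComb_notMem_maximalIdeal_pow`.
NOT covered: integrality for `d ≫ 0`, transversal `A₁` off finitely many points, projective gluing.
[cite: Hartshorne1977, II Thm. 8.18] [cite: Matsumura1987, Thm. 14.2] [OURS · L1 W4.5b] helper H-L0b
toward `stub_elnat_three` of crux `EquisingularLiftNat` (stmt-ResolutionOfSingularities-20038); NOT a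
statement of the manuscript. -/
theorem occurs_as_singular_locus_ord_two [IsAlgClosed k] [IsRegularRing A] [IsDomain A]
    [Algebra.FiniteType k A] (𝔭 : Ideal A) [𝔭.IsPrime] (h𝔭 : 𝔭 ≠ ⊥) :
    ∃ (ι : Type u) (_ : Fintype ι) (u : ι → A), (∀ j, u j ∈ 𝔭 ^ 2) ∧
      IsGeneric fun t : ι → k =>
        linComb u t ≠ 0 ∧ linComb u t ∈ 𝔭 ^ 2 ∧
        algebraMap A (Localization.AtPrime 𝔭) (linComb u t) ∉
          maximalIdeal (Localization.AtPrime 𝔭) ^ 3 ∧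
        ∀ (𝔪 : Ideal A) [𝔪.IsMaximal], linComb u t ∈ 𝔪 →
          (IsRegularLocalRing (Localization.AtPrime 𝔪 ⧸
              Ideal.span {algebraMap A (Localization.AtPrime 𝔪) (linComb u t)}) ↔ ¬ 𝔭 ≤ 𝔪) := by
  classical
  obtain ⟨T, hT⟩ := (IsNoetherian.noetherian (𝔭 ^ 2) : (𝔭 ^ 2).FG)
  obtain ⟨s, hs⟩ := (Algebra.FiniteType.out : (⊤ : Subalgebra k A).FG)
  have hsub : (T : Set A) ⊆ ↑(𝔭 ^ 2) := hT ▸ Ideal.subset_span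
  let u : ↥T × Option ↥s → A := fun p => (p.1 : A) * p.2.elim 1 Subtype.val
  have hu2 : ∀ p, u p ∈ 𝔭 ^ 2 := fun p => Ideal.mul_mem_right _ _ (hsub p.1.2)
  have hoff : ∀ 𝔪 : Ideal A, 𝔪.IsMaximal → ¬ 𝔭 ≤ 𝔪 →
      Function.Surjective (linCombQuotSq (k := k) u 𝔪) :=
    fun 𝔪 _ hp𝔪 => surjective_linCombQuotSq_sqSystem hT hs 𝔪 hp𝔪
  obtain ⟨g, hgT, hg3⟩ := exists_mem_notMem_maximalIdeal_pow_three 𝔭 h𝔭 hT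
  have hug : u (⟨g, hgT⟩, none) = g := by simp [u]
  have hg0 : g ≠ 0 := by
    rintro rfl
    exact hg3 (by rw [map_zero]; exact zero_mem _)
  have hne : ∃ j, u j ≠ 0 := ⟨(⟨g, hgT⟩, none), by rwa [hug]⟩
  have hord : ∃ j, algebraMap A (Localization.AtPrime 𝔭) (u j) ∉
      maximalIdeal (Localization.AtPrime 𝔭) ^ 3 := ⟨(⟨g, hgT⟩, none), by rwa [hug]⟩
  have hmem : ∀ t : ↥T × Option ↥s → k, linComb u t ∈ 𝔭 ^ 2 := fun t =>
    Ideal.sum_mem _ fun j _ => by rw [Algebra.smul_def]; exact Ideal.mul_mem_left _ _ (hu2 j)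
  have hA := isGeneric_isRegularLocalRing_quotient_linComb_off (k := k) 𝔭 u hoff
  have hB := isGeneric_linComb_ne_zero (k := k) u hne
  have hC := isGeneric_linComb_notMem_maximalIdeal_pow (k := k) 𝔭 3 u hord
  refine ⟨_, inferInstance, u, hu2, ((hA.and hB).and hC).mono fun t ht =>
    ⟨ht.1.2, hmem t, ht.2, fun 𝔪 h𝔪 hst => ⟨fun hreg hp𝔪 => ?_, fun hp𝔪 => ht.1.1 𝔪 hp𝔪 hst⟩⟩⟩
  exact not_isRegularLocalRing_quotient_of_mem_sq 𝔪 ht.1.2 (Ideal.pow_right_mono hp𝔪 2 (hmem t)) hreg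

end Summit.ResolutionOfSingularities.ResolutionOfSingularities.Cruxes.EquisingularLiftNat.Sections

end
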